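import Literature.Combinatorics.Additive.StevensDeZeeuwIncidenceProofs
import Mathlib.Algebra.CharP.Algebra
import Mathlib.Algebra.MvPolynomial.Funext
import Mathlib.FieldTheory.IsAlgClosed.AlgebraicClosure
import Mathlib.LinearAlgebra.FiniteDimensional.Lemmas
import Mathlib.LinearAlgebra.Matrix.Adjugate
import Mathlib.LinearAlgebra.Matrix.MvPolynomial
import HarnessLib

/-!
# Rudnev's point–plane theorem from the bipartite Guth–Katz line bound (de Zeeuw 2016, §§2, 4)

Topic `Literature/Combinatorics/Additive` (incidence geometry over arbitrary fields). Everything in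
this file is PROVED; the one deep input is taken as an explicit hypothesis, stated inline.

F. de Zeeuw, *A short proof of Rudnev's point–plane incidence bound*, arXiv:1612.02719 (2016),
proves Rudnev's theorem [Rudnev2017, Theorem 3] in the point form

> **Theorem 1.1.** Let `P` be a finite set of points in `𝔽³` and `Q` a finite set of planes in
> `𝔽³`. Assume that `|P| ≤ |Q|`, and if `𝔽` has positive characteristic `p`, assume that
> `|P| = O(p²)`. Suppose that no line contains `k` points of `P`. Then
> `I(P, Q) = O(|P|^{1/2}|Q| + k|Q|)`

(= [StevensDeZeeuw2017, Theorem 6], the exact hypothesis of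
`Literature.Combinatorics.Additive.stevensDeZeeuw_thm4_of_pointPlane`) in two steps:

* **§2, Lemma 2.1** — explicit maps `φ` (points ↦ lines of `𝔽³`) and `ψ` (planes ↦ lines of
  `𝔽³`) with `p ∈ q ⟺ φ(p) ∩ ψ(q) ≠ ∅`;
* **§4, proof of Theorem 4.1** — after a generic projective transformation (over an infinite
  extension of `𝔽`), `I(P, Q) = I(φ(P), ψ(Q))`, and no quadric contains `k` lines of `φ(P)` and
  `k` lines of `ψ(Q)` unless `k` points of `P` are collinear; conclude by

* **§3, Lemma 3.1** (the bipartite Guth–Katz intersection bound over arbitrary fields, after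
  Guth–Katz [Ann. Math. 181 (2015)] and Kollár [Kollar2015]): "Let `L, M` be two finite sets of
  lines in `𝔽³`. Assume that `|L| ≤ |M|`, and if `𝔽` has positive characteristic `p`, assume that
  `|L| = O(p²)`. Suppose that no quadric contains `s` lines of `L` and `t` lines of `M`. Then
  `I(L, M) = O(|L|^{1/2}|M| + t|L| + s|M|)`", where `I(L, M)` is the number of points lying on a
  line of `L` and on a line of `M`, and "a quadric is an algebraic surface of degree two (which
  may be a union of two planes)".

This file formalizes §2 and §4 completely: the main theorem
`rudnev_pointPlaneIncidence_of_lineIntersection_closed` derives Theorem 1.1 (verbatim the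
hypothesis of `stevensDeZeeuw_thm4_of_pointPlane`) from Lemma 3.1 taken as an inline hypothesis
for algebraically closed fields only (the printed proof passes to an infinite extension of `𝔽`;
we use `AlgebraicClosure 𝔽`, and Kollár's theory behind Lemma 3.1 is set over algebraically
closed fields), `rudnev_pointPlaneIncidence_of_lineIntersection` is the special case where
Lemma 3.1 is assumed for all fields, and `stevensDeZeeuw_thm4_of_lineIntersection_closed` /
`stevensDeZeeuw_thm4_of_lineIntersection` chain them with the (proved) §2 reduction of
Stevens–de Zeeuw, so that the named fact `stevensDeZeeuw_thm4` is reduced to Lemma 3.1 alone —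
the Guth–Katz–Kollár theory of lines on ruled / non-ruled surfaces over arbitrary fields
(Cayley–Salmon–Monge flecnode theorem, [Kollar2015, §§3–5]), which is deliberately NOT reproduced
here (its first step, interpolation of a surface of degree `O(√|L|)` through `L`, is
`Literature.Combinatorics.Extremal.exists_surface_through_lines`).

## The rendering of Lemma 3.1 (hypothesis `H` of the main theorem)

Lines of `𝔽³` are affine subspaces of `Fin 3 → 𝔽` with direction of rank `1` (as in the Rudnev
statement); a quadric "containing" a line means a nonzero `G : MvPolynomial (Fin 3) 𝔽` of total
degree `≤ 2` vanishing at every point of the line (degree `≤ 2` covers planes and the union of two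
planes, as printed; restricting to *nonzero* `G` of degree *at most* two only weakens the
hypothesis we assume); "no quadric contains `s` lines of `L` and `t` lines of `M`" is: for every
such `G`, fewer than `s` lines of `L` or fewer than `t` lines of `M` lie on `G`; `L` and `M` are
disjoint (implicit in the paper: a common line would have infinitely many "intersection points");
the conclusion bounds the size of every finite set of points each lying on a line of `L` and a
line of `M`; "`|L| = O(p²)`" is `∀ c₀ ∃ C` as everywhere in this story.

## Proof architecture (de Zeeuw §§2, 4, made coordinate-explicit and classification-free)

* *Plane equations.* Every plane `q` of `𝔽³` is `{z : n·z = δ}` with `n ≠ 0`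
  (`exists_equation_of_finrank_eq_two`); write `p̂ = (p, 1)`, `q̂ = (n, -δ) ∈ 𝔽⁴`, so that
  `p ∈ q ⟺ p̂ · q̂ = 0`, and pass to `K = AlgebraicClosure 𝔽` (infinite, same characteristic —
  de Zeeuw's footnote: "we can pass to any infinite extension of `𝔽`").
* *Generic projective transformation* (`exists_generic`). For `g ∈ GL₄(K)` put `x = g p̂`,
  `y = adj(g)ᵀ q̂`; then `x · y = det g · (p̂ · q̂)`. Genericity is obtained from the generic matrix
  `Matrix.mvPolynomialX`: each requirement is the non-vanishing of a polynomial in the 16 entries,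
  each polynomial is shown nonzero by one evaluation, and a nonzero polynomial over an infinite
  field has a non-root (`MvPolynomial.funext`). Requirements: `x₀ ≠ 0`, `p ↦ x₃/x₀` and
  `p ↦ x₁/x₀` injective on `P`; `y₂ ≠ 0`, `q ↦ y₁/y₂` and `q ↦ y₃/y₂` injective on `Q`.
* *The maps* (Lemma 2.1 in coordinates; `lineL`, `lineM`, `meet_iff_dot`). With `B = x₁/x₀`,
  `U = 1 - x₃/x₀`, `V = x₂/x₀` and `A = -y₃/y₂`, `S = y₁/y₂`, `W = (-y₃-y₀)/y₂`,
  `φ(p) = {(a, B, U a + V)}` and `ψ(q) = {(A, b, W - S b)}` (these ARE de Zeeuw's `φ(p)`, `ψ(q)`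
  for the transformed point/plane, computed from his proof of Lemma 2.1), and
  `φ(p) ∩ ψ(q) ≠ ∅ ⟺ U A + V + S B = W ⟺ x · y = 0 ⟺ p ∈ q`.
* *Counting* (§4): the `L`-lines have distinct `B`, the `M`-lines distinct `A`, so incident pairs
  `(p, q)` inject into intersection points, `|L| = |P|`, `|M| = |Q|`, `L ∩ M = ∅`.
* *The quadric step* (`quadric_meet`, replacing de Zeeuw's argument with the two rulings of a
  doubly-ruled quadric by a direct computation valid for every, possibly reducible, surface of
  degree `≤ 2`): if `G ≠ 0`, `deg G ≤ 2`, vanishes on three `L`-lines with distinct `U` and distinct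
  `B` and on two `M`-lines with distinct `S`, then the coefficients of `X₀², X₀X₂, X₂², X₁X₂, X₁²`
  vanish and that of `X₂` does not, so `{G = 0}` is a graph over the `(X₀, X₁)`-plane and every
  `L`-line on it meets every `M`-line on it. Hence `k + 1` lines of each family on a quadric give
  `k + 1` points of `P` on two distinct planes of `Q`, i.e. `k + 1` collinear points of `P`
  (`exists_line_of_two_planes`) — excluded.
* *Constants:* with `s = t = k + 1` Lemma 3.1 gives `I ≤ C_H (|P|^{1/2}|Q| + (k+1)|P| + (k+1)|Q|)
  ≤ 4 C_H (|P|^{1/2}|Q| + k|Q|)` for `k ≥ 2`; `k = 1` forces `|P| ≤ 1` and `k = 0` forces `P = ∅`;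
  we take `C = 4 C_H + 1`.

## References
* [deZeeuw2016] F. de Zeeuw, *A short proof of Rudnev's point-plane incidence bound*,
  arXiv:1612.02719 — Lemma 2.1, Lemma 3.1, Theorem 1.1, proof of Theorem 4.1.
* [Rudnev2017] M. Rudnev, Combinatorica 38 (2018) 219–254 — Theorem 3.
* [StevensDeZeeuw2017] S. Stevens, F. de Zeeuw, Bull. Lond. Math. Soc. 49 (2017) — Thm 4, Thm 6.
* [Kollar2015] J. Kollár, Adv. Math. 271 (2015) 30–61 — the source of Lemma 3.1's tools.
-/

namespace Literature.Combinatorics.Additive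

open Finset Matrix MvPolynomial

namespace DeZeeuw

/-! ### Generic `4 × 4` matrices: polynomial conditions in the entries -/

section Generic

variable {K : Type*} [Field K]

/-- The entries of a `4 × 4` matrix as a valuation of the variables of the generic matrix
`Matrix.mvPolynomialX (Fin 4) (Fin 4) K`. [folklore] -/
def ent (g : Matrix (Fin 4) (Fin 4) K) : Fin 4 × Fin 4 → K := fun ij => g ij.1 ij.2

/-- Evaluating the generic matrix at `ent g` gives `g`. [folklore] -/
theorem mapMatrix_eval_X (g : Matrix (Fin 4) (Fin 4) K) :
    (MvPolynomial.eval (ent g)).mapMatrix (Matrix.mvPolynomialX (Fin 4) (Fin 4) K) = g :=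
  Matrix.mvPolynomialX_mapMatrix_eval g

/-- The `i`-th coordinate of `X v` as a polynomial in the entries of the generic matrix `X`.
[folklore] -/
noncomputable def rowPoly (i : Fin 4) (v : Fin 4 → K) : MvPolynomial (Fin 4 × Fin 4) K :=
  ∑ k, (Matrix.mvPolynomialX (Fin 4) (Fin 4) K) i k * C (v k)

/-- `rowPoly i v` evaluates at `g` to `(g v)ᵢ`. [folklore] -/
theorem eval_rowPoly (g : Matrix (Fin 4) (Fin 4) K) (i : Fin 4) (v : Fin 4 → K) :
    eval (ent g) (rowPoly i v) = (g *ᵥ v) i := by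
  simp [rowPoly, Matrix.mulVec, dotProduct, ent, map_sum]

/-- The `i`-th coordinate of `adj(X)ᵀ v` as a polynomial in the entries of `X`. [folklore] -/
noncomputable def adjRowPoly (i : Fin 4) (v : Fin 4 → K) : MvPolynomial (Fin 4 × Fin 4) K :=
  ∑ k, (Matrix.mvPolynomialX (Fin 4) (Fin 4) K).adjugate k i * C (v k)

/-- The adjugate of the generic matrix evaluates to the adjugate. [folklore] -/
theorem eval_adjugate_X (g : Matrix (Fin 4) (Fin 4) K) (k i : Fin 4) :
    eval (ent g) ((Matrix.mvPolynomialX (Fin 4) (Fin 4) K).adjugate k i) = g.adjugate k i := by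
  have h := RingHom.map_adjugate (MvPolynomial.eval (ent g))
    (Matrix.mvPolynomialX (Fin 4) (Fin 4) K)
  rw [mapMatrix_eval_X] at h
  have := congrFun (congrFun h k) i
  simpa [RingHom.mapMatrix_apply, Matrix.map_apply] using this

/-- `adjRowPoly i v` evaluates at `g` to `(adj(g)ᵀ v)ᵢ`. [folklore] -/
theorem eval_adjRowPoly (g : Matrix (Fin 4) (Fin 4) K) (i : Fin 4) (v : Fin 4 → K) :
    eval (ent g) (adjRowPoly i v) = ((g.adjugate)ᵀ *ᵥ v) i := by
  simp [adjRowPoly, Matrix.mulVec, dotProduct, map_sum, eval_adjugate_X, Matrix.transpose_apply]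

/-- The generic determinant evaluates to the determinant. [folklore] -/
theorem eval_det_X (g : Matrix (Fin 4) (Fin 4) K) :
    eval (ent g) (Matrix.mvPolynomialX (Fin 4) (Fin 4) K).det = g.det := by
  rw [RingHom.map_det, mapMatrix_eval_X]

/-- Over an infinite field a nonzero polynomial takes a nonzero value (`MvPolynomial.funext`).
[folklore] -/
theorem exists_eval_ne_zero [Infinite K] {ι : Type*} {Φ : MvPolynomial ι K} (hΦ : Φ ≠ 0) :
    ∃ w : ι → K, eval w Φ ≠ 0 := by
  by_contra h
  push Not at h
  exact hΦ (MvPolynomial.funext fun w => by rw [h w, map_zero])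

/-- Matrix form of `exists_eval_ne_zero` for the generic `4 × 4` matrix. [folklore] -/
theorem exists_matrix_eval_ne_zero [Infinite K] {Φ : MvPolynomial (Fin 4 × Fin 4) K}
    (hΦ : Φ ≠ 0) : ∃ g : Matrix (Fin 4) (Fin 4) K, eval (ent g) Φ ≠ 0 := by
  obtain ⟨w, hw⟩ := exists_eval_ne_zero hΦ
  refine ⟨Matrix.of fun i j => w (i, j), ?_⟩
  have : ent (Matrix.of fun i j => w (i, j) : Matrix (Fin 4) (Fin 4) K) = w := by
    funext ⟨i, j⟩; rfl
  rwa [this]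

/-- The single-entry matrix `E_{ik}`. [folklore] -/
def E1 (i k : Fin 4) : Matrix (Fin 4) (Fin 4) K :=
  Matrix.of fun a b => if a = i ∧ b = k then 1 else 0

/-- `E_{ik} v = v_k e_i`. [folklore] -/
theorem E1_mulVec (i k : Fin 4) (v : Fin 4 → K) (a : Fin 4) :
    (E1 i k *ᵥ v) a = if a = i then v k else 0 := by
  simp only [E1, Matrix.mulVec, dotProduct, Matrix.of_apply]
  split_ifs with h
  · subst h
    simp
  · simp [h]

/-- `rowPoly i v ≠ 0` for `v ≠ 0` (evaluate at `E_{ik}` with `v_k ≠ 0`). [folklore] -/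
theorem rowPoly_ne_zero (i : Fin 4) {v : Fin 4 → K} (hv : v ≠ 0) : rowPoly i v ≠ 0 := by
  obtain ⟨k, hk⟩ := Function.ne_iff.1 hv
  intro h
  have := eval_rowPoly (E1 i k) i v
  rw [h, map_zero, E1_mulVec, if_pos rfl] at this
  exact hk this.symm

/-- The `2 × 2` minor `(X v)_j (X v')_i - (X v)_i (X v')_j` of the transformed pair. [folklore] -/
noncomputable def minorPoly (j i : Fin 4) (v v' : Fin 4 → K) : MvPolynomial (Fin 4 × Fin 4) K :=
  rowPoly j v * rowPoly i v' - rowPoly i v * rowPoly j v'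

/-- Evaluation of `minorPoly`. [folklore] -/
theorem eval_minorPoly (g : Matrix (Fin 4) (Fin 4) K) (j i : Fin 4) (v v' : Fin 4 → K) :
    eval (ent g) (minorPoly j i v v') =
      (g *ᵥ v) j * (g *ᵥ v') i - (g *ᵥ v) i * (g *ᵥ v') j := by
  simp [minorPoly, eval_rowPoly]

/-- `minorPoly j i v v' ≠ 0` as soon as `v, v'` are not proportional (some `2 × 2` minor of
`(v | v')` is nonzero): evaluate at `E_{jl} + E_{ik}`. [folklore] -/
theorem minorPoly_ne_zero {j i : Fin 4} (hji : j ≠ i) {v v' : Fin 4 → K}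
    (h : ∃ k l, v k * v' l - v l * v' k ≠ 0) : minorPoly j i v v' ≠ 0 := by
  obtain ⟨k, l, hkl⟩ := h
  intro h0
  have := eval_minorPoly (E1 j l + E1 i k) j i v v'
  rw [h0, map_zero] at this
  simp [Matrix.add_mulVec, E1_mulVec, hji, hji.symm] at this
  apply hkl
  linear_combination this

/-- The `adj(X)ᵀ`-version of `minorPoly`. [folklore] -/
noncomputable def adjMinorPoly (j i : Fin 4) (w w' : Fin 4 → K) :
    MvPolynomial (Fin 4 × Fin 4) K :=
  adjRowPoly j w * adjRowPoly i w' - adjRowPoly i w * adjRowPoly j w'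

/-- Evaluation of `adjMinorPoly`. [folklore] -/
theorem eval_adjMinorPoly (g : Matrix (Fin 4) (Fin 4) K) (j i : Fin 4) (w w' : Fin 4 → K) :
    eval (ent g) (adjMinorPoly j i w w') =
      ((g.adjugate)ᵀ *ᵥ w) j * ((g.adjugate)ᵀ *ᵥ w') i
        - ((g.adjugate)ᵀ *ᵥ w) i * ((g.adjugate)ᵀ *ᵥ w') j := by
  simp [adjMinorPoly, eval_adjRowPoly]

/-- `adj(adj(h)ᵀ)ᵀ = det(h)² h` for `4 × 4` matrices. [folklore] -/
theorem adjT_adjT (h : Matrix (Fin 4) (Fin 4) K) :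
    ((h.adjugate)ᵀ.adjugate)ᵀ = h.det ^ 2 • h := by
  rw [← Matrix.adjugate_transpose, Matrix.transpose_transpose,
    Matrix.adjugate_adjugate _ (by simp)]
  simp

/-- `adjRowPoly i w ≠ 0` for `w ≠ 0`: take `h₀` with `det h₀ ≠ 0`, `(h₀ w)ᵢ ≠ 0` and evaluate at
`g₀ = adj(h₀)ᵀ`, for which `adj(g₀)ᵀ = det(h₀)² h₀`. [folklore] -/
theorem adjRowPoly_ne_zero [Infinite K] (i : Fin 4) {w : Fin 4 → K} (hw : w ≠ 0) :
    adjRowPoly i w ≠ 0 := by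
  obtain ⟨h₀, hh₀⟩ := exists_matrix_eval_ne_zero
    (mul_ne_zero (rowPoly_ne_zero i hw) (Matrix.det_mvPolynomialX_ne_zero (Fin 4) K))
  rw [map_mul, eval_rowPoly, eval_det_X] at hh₀
  obtain ⟨h1, h2⟩ := mul_ne_zero_iff.1 hh₀
  intro H
  have := eval_adjRowPoly ((h₀.adjugate)ᵀ) i w
  rw [H, map_zero, adjT_adjT, Matrix.smul_mulVec, Pi.smul_apply, smul_eq_mul] at this
  exact mul_ne_zero (pow_ne_zero 2 h2) h1 this.symm

/-- `adjMinorPoly j i w w' ≠ 0` for non-proportional `w, w'` (same device). [folklore] -/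
theorem adjMinorPoly_ne_zero [Infinite K] {j i : Fin 4} (hji : j ≠ i) {w w' : Fin 4 → K}
    (h : ∃ k l, w k * w' l - w l * w' k ≠ 0) : adjMinorPoly j i w w' ≠ 0 := by
  obtain ⟨h₀, hh₀⟩ := exists_matrix_eval_ne_zero
    (mul_ne_zero (minorPoly_ne_zero hji h) (Matrix.det_mvPolynomialX_ne_zero (Fin 4) K))
  rw [map_mul, eval_minorPoly, eval_det_X] at hh₀
  obtain ⟨h1, h2⟩ := mul_ne_zero_iff.1 hh₀
  intro H
  have := eval_adjMinorPoly ((h₀.adjugate)ᵀ) j i w w'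
  rw [H, map_zero, adjT_adjT] at this
  simp only [Matrix.smul_mulVec, Pi.smul_apply, smul_eq_mul] at this
  have h3 : (h₀.det ^ 2) ^ 2 *
      ((h₀ *ᵥ w) j * (h₀ *ᵥ w') i - (h₀ *ᵥ w) i * (h₀ *ᵥ w') j) = 0 := by
    rw [this]; ring
  exact mul_ne_zero (pow_ne_zero 2 (pow_ne_zero 2 h2)) h1 h3

/-- **Generic projective transformation** (the "generic rotation" of de Zeeuw's proof of
Theorem 4.1, over an infinite field). Given finite sets `V, W` of nonzero, pairwise
non-proportional vectors of `K⁴`, there is an invertible `g` such that, with `x = g v` (`v ∈ V`)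
and `y = adj(g)ᵀ w` (`w ∈ W`): `x₀ ≠ 0`, the maps `v ↦ x₃/x₀` and `v ↦ x₁/x₀` are injective on
`V`; `y₂ ≠ 0`, the maps `w ↦ y₁/y₂` and `w ↦ y₃/y₂` are injective on `W` (all stated
multiplied out). [cite: deZeeuw2016, §4, proof of Theorem 4.1 (generic rotation, footnote)] -/
theorem exists_generic [Infinite K] (V W : Finset (Fin 4 → K))
    (hV : ∀ v ∈ V, v ≠ 0)
    (hVV : ∀ v ∈ V, ∀ v' ∈ V, v ≠ v' → ∃ k l, v k * v' l - v l * v' k ≠ 0)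
    (hW : ∀ w ∈ W, w ≠ 0)
    (hWW : ∀ w ∈ W, ∀ w' ∈ W, w ≠ w' → ∃ k l, w k * w' l - w l * w' k ≠ 0) :
    ∃ g : Matrix (Fin 4) (Fin 4) K, g.det ≠ 0 ∧
      (∀ v ∈ V, (g *ᵥ v) 0 ≠ 0) ∧
      (∀ v ∈ V, ∀ v' ∈ V, v ≠ v' →
        (g *ᵥ v) 3 * (g *ᵥ v') 0 - (g *ᵥ v) 0 * (g *ᵥ v') 3 ≠ 0) ∧
      (∀ v ∈ V, ∀ v' ∈ V, v ≠ v' →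
        (g *ᵥ v) 1 * (g *ᵥ v') 0 - (g *ᵥ v) 0 * (g *ᵥ v') 1 ≠ 0) ∧
      (∀ w ∈ W, ((g.adjugate)ᵀ *ᵥ w) 2 ≠ 0) ∧
      (∀ w ∈ W, ∀ w' ∈ W, w ≠ w' →
        ((g.adjugate)ᵀ *ᵥ w) 1 * ((g.adjugate)ᵀ *ᵥ w') 2
          - ((g.adjugate)ᵀ *ᵥ w) 2 * ((g.adjugate)ᵀ *ᵥ w') 1 ≠ 0) ∧
      (∀ w ∈ W, ∀ w' ∈ W, w ≠ w' →
        ((g.adjugate)ᵀ *ᵥ w) 3 * ((g.adjugate)ᵀ *ᵥ w') 2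
          - ((g.adjugate)ᵀ *ᵥ w) 2 * ((g.adjugate)ᵀ *ᵥ w') 3 ≠ 0) := by
  classical
  set Φ : MvPolynomial (Fin 4 × Fin 4) K :=
    (Matrix.mvPolynomialX (Fin 4) (Fin 4) K).det *
      (∏ v ∈ V, rowPoly 0 v) *
      (∏ v ∈ V, ∏ v' ∈ V.erase v, (minorPoly 3 0 v v' * minorPoly 1 0 v v')) *
      (∏ w ∈ W, adjRowPoly 2 w) *
      (∏ w ∈ W, ∏ w' ∈ W.erase w, (adjMinorPoly 1 2 w w' * adjMinorPoly 3 2 w w')) with hΦ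
  have hne : Φ ≠ 0 := by
    refine mul_ne_zero (mul_ne_zero (mul_ne_zero (mul_ne_zero
      (Matrix.det_mvPolynomialX_ne_zero (Fin 4) K) ?_) ?_) ?_) ?_
    · exact prod_ne_zero_iff.2 fun v hv => rowPoly_ne_zero 0 (hV v hv)
    · refine prod_ne_zero_iff.2 fun v hv => prod_ne_zero_iff.2 fun v' hv' => ?_
      have hvv' : v ≠ v' := (ne_of_mem_erase hv').symm
      exact mul_ne_zero
        (minorPoly_ne_zero (by decide) (hVV v hv v' (mem_of_mem_erase hv') hvv'))
        (minorPoly_ne_zero (by decide) (hVV v hv v' (mem_of_mem_erase hv') hvv'))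
    · exact prod_ne_zero_iff.2 fun w hw => adjRowPoly_ne_zero 2 (hW w hw)
    · refine prod_ne_zero_iff.2 fun w hw => prod_ne_zero_iff.2 fun w' hw' => ?_
      have hww' : w ≠ w' := (ne_of_mem_erase hw').symm
      exact mul_ne_zero
        (adjMinorPoly_ne_zero (by decide) (hWW w hw w' (mem_of_mem_erase hw') hww'))
        (adjMinorPoly_ne_zero (by decide) (hWW w hw w' (mem_of_mem_erase hw') hww'))
  obtain ⟨g, hg⟩ := exists_matrix_eval_ne_zero hne
  simp only [hΦ, map_mul, map_prod, mul_ne_zero_iff, prod_ne_zero_iff, eval_det_X, eval_rowPoly,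
    eval_minorPoly, eval_adjRowPoly, eval_adjMinorPoly] at hg
  obtain ⟨⟨⟨⟨hdet, h0⟩, h1⟩, h2⟩, h3⟩ := hg
  exact ⟨g, hdet, h0, fun v hv v' hv' hne' => (h1 v hv v' (mem_erase.2 ⟨hne'.symm, hv'⟩)).1,
    fun v hv v' hv' hne' => (h1 v hv v' (mem_erase.2 ⟨hne'.symm, hv'⟩)).2, h2,
    fun w hw w' hw' hne' => (h3 w hw w' (mem_erase.2 ⟨hne'.symm, hw'⟩)).1,
    fun w hw w' hw' hne' => (h3 w hw w' (mem_erase.2 ⟨hne'.symm, hw'⟩)).2⟩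

/-- The pairing is preserved up to `det`: `(g a) · (adj(g)ᵀ b) = det g · (a · b)`. [folklore] -/
theorem mulVec_dotProduct_adjugate (g : Matrix (Fin 4) (Fin 4) K) (a b : Fin 4 → K) :
    (g *ᵥ a) ⬝ᵥ ((g.adjugate)ᵀ *ᵥ b) = g.det * (a ⬝ᵥ b) := by
  rw [Matrix.mulVec_transpose, dotProduct_comm, Matrix.dotProduct_mulVec, Matrix.vecMul_vecMul,
    Matrix.adjugate_mul, Matrix.vecMul_smul, Matrix.vecMul_one, smul_dotProduct, smul_eq_mul,
    dotProduct_comm]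

end Generic

/-! ### The two line families (de Zeeuw's `φ(p)` and `ψ(q)` in coordinates) -/

section Lines

variable {K : Type*} [Field K]

/-- `B = x₁/x₀` (the plane `y = B` containing `φ(p)`). [cite: deZeeuw2016, Lemma 2.1] -/
def cB (x : Fin 4 → K) : K := x 1 / x 0

/-- `U = 1 - x₃/x₀` (the slope of `φ(p)`). [cite: deZeeuw2016, Lemma 2.1] -/
def cU (x : Fin 4 → K) : K := 1 - x 3 / x 0

/-- `V = x₂/x₀` (the intercept of `φ(p)`). [cite: deZeeuw2016, Lemma 2.1] -/
def cV (x : Fin 4 → K) : K := x 2 / x 0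

/-- `A = -y₃/y₂` (the plane `x = A` containing `ψ(q)`). [cite: deZeeuw2016, Lemma 2.1] -/
def cA (y : Fin 4 → K) : K := -y 3 / y 2

/-- `S = y₁/y₂` (minus the slope of `ψ(q)`). [cite: deZeeuw2016, Lemma 2.1] -/
def cS (y : Fin 4 → K) : K := y 1 / y 2

/-- `W = (-y₃ - y₀)/y₂` (the intercept of `ψ(q)`). [cite: deZeeuw2016, Lemma 2.1] -/
def cW (y : Fin 4 → K) : K := (-y 3 - y 0) / y 2

/-- `φ`: the line `{(a, B, U a + V) : a ∈ K}` of `K³` attached to the (transformed, homogeneous)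
point `x`. [cite: deZeeuw2016, §2 (φ) and Lemma 2.1] -/
def lineL (x : Fin 4 → K) : AffineSubspace K (Fin 3 → K) :=
  AffineSubspace.mk' ![0, cB x, cV x] (K ∙ ![1, 0, cU x])

/-- `ψ`: the line `{(A, b, W - S b) : b ∈ K}` of `K³` attached to the (transformed, homogeneous)
plane `y`. [cite: deZeeuw2016, §2 (ψ) and Lemma 2.1] -/
def lineM (y : Fin 4 → K) : AffineSubspace K (Fin 3 → K) :=
  AffineSubspace.mk' ![cA y, 0, cW y] (K ∙ ![0, 1, -cS y])

/-- Membership in `lineL x`. [cite: deZeeuw2016, Lemma 2.1] -/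
theorem mem_lineL {x : Fin 4 → K} {z : Fin 3 → K} :
    z ∈ lineL x ↔ z 1 = cB x ∧ z 2 = cU x * z 0 + cV x := by
  simp only [lineL, AffineSubspace.mem_mk', Submodule.mem_span_singleton]
  constructor
  · rintro ⟨t, ht⟩
    have h0 := congr_fun ht 0
    have h1 := congr_fun ht 1
    have h2 := congr_fun ht 2
    simp at h0 h1 h2
    constructor
    · linear_combination -h1
    · rw [← h0]; linear_combination -h2
  · rintro ⟨h1, h2⟩
    refine ⟨z 0, ?_⟩
    ext i
    fin_cases i <;> simp [h1, h2, mul_comm]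

/-- Membership in `lineM y`. [cite: deZeeuw2016, Lemma 2.1] -/
theorem mem_lineM {y : Fin 4 → K} {z : Fin 3 → K} :
    z ∈ lineM y ↔ z 0 = cA y ∧ z 2 = cW y - cS y * z 1 := by
  simp only [lineM, AffineSubspace.mem_mk', Submodule.mem_span_singleton]
  constructor
  · rintro ⟨t, ht⟩
    have h0 := congr_fun ht 0
    have h1 := congr_fun ht 1
    have h2 := congr_fun ht 2
    simp at h0 h1 h2
    constructor
    · linear_combination -h0
    · rw [← h1]; linear_combination -h2
  · rintro ⟨h0, h2⟩
    refine ⟨z 1, ?_⟩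
    ext i
    fin_cases i <;> simp [h0, h2, mul_comm]

/-- `lineL x` is a line. [cite: deZeeuw2016, Lemma 2.1] -/
theorem finrank_direction_lineL (x : Fin 4 → K) :
    Module.finrank K (lineL x).direction = 1 := by
  rw [lineL, AffineSubspace.direction_mk']
  exact finrank_span_singleton fun h => by simpa using congr_fun h 0

/-- `lineM y` is a line. [cite: deZeeuw2016, Lemma 2.1] -/
theorem finrank_direction_lineM (y : Fin 4 → K) :
    Module.finrank K (lineM y).direction = 1 := by
  rw [lineM, AffineSubspace.direction_mk']
  exact finrank_span_singleton fun h => by simpa using congr_fun h 1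

/-- A `φ`-line is never a `ψ`-line (they lie in planes `y = B`, resp. `x = A`). [folklore] -/
theorem lineL_ne_lineM (x y : Fin 4 → K) : lineL x ≠ lineM y := by
  intro h
  have h1 : (![0, cB x, cV x] : Fin 3 → K) ∈ lineL x := by rw [mem_lineL]; simp
  have h2 : (![1, cB x, cU x + cV x] : Fin 3 → K) ∈ lineL x := by rw [mem_lineL]; simp
  rw [h, mem_lineM] at h1 h2
  have e1 := h1.1
  have e2 := h2.1
  simp at e1 e2
  exact one_ne_zero (e2.trans e1.symm)

/-- `lineL` remembers `B`. [folklore] -/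
theorem cB_eq_of_lineL_eq {x x' : Fin 4 → K} (h : lineL x = lineL x') : cB x = cB x' := by
  have h1 : (![0, cB x, cV x] : Fin 3 → K) ∈ lineL x := by rw [mem_lineL]; simp
  rw [h, mem_lineL] at h1
  simpa using h1.1

/-- `lineM` remembers `A`. [folklore] -/
theorem cA_eq_of_lineM_eq {y y' : Fin 4 → K} (h : lineM y = lineM y') : cA y = cA y' := by
  have h1 : (![cA y, 0, cW y] : Fin 3 → K) ∈ lineM y := by rw [mem_lineM]; simp
  rw [h, mem_lineM] at h1
  simpa using h1.1

/-- The candidate meeting point `(A, B, U A + V)` of `φ(p)` and `ψ(q)` (the point `ℓ*` of the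
proof of Lemma 2.1). [cite: deZeeuw2016, Lemma 2.1] -/
def meetPt (x y : Fin 4 → K) : Fin 3 → K := ![cA y, cB x, cU x * cA y + cV x]

/-- `meetPt x y ∈ lineL x`. [cite: deZeeuw2016, Lemma 2.1] -/
theorem meetPt_mem_lineL (x y : Fin 4 → K) : meetPt x y ∈ lineL x := by
  rw [mem_lineL]; simp [meetPt]

/-- `meetPt x y ∈ lineM y` iff `U A + V + S B = W`. [cite: deZeeuw2016, Lemma 2.1] -/
theorem meetPt_mem_lineM_iff (x y : Fin 4 → K) :
    meetPt x y ∈ lineM y ↔ cU x * cA y + cV x + cS y * cB x = cW y := by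
  rw [mem_lineM]
  simp only [meetPt, Matrix.cons_val_zero, Matrix.cons_val_one, Matrix.head_cons,
    Matrix.cons_val_two, Matrix.tail_cons, true_and]
  constructor <;> intro h <;> linear_combination h

/-- `φ(p)` meets `ψ(q)` iff `U A + V + S B = W`. [cite: deZeeuw2016, Lemma 2.1] -/
theorem meet_iff (x y : Fin 4 → K) :
    (∃ z, z ∈ lineL x ∧ z ∈ lineM y) ↔ cU x * cA y + cV x + cS y * cB x = cW y := by
  constructor
  · rintro ⟨z, hzL, hzM⟩
    rw [mem_lineL] at hzL
    rw [mem_lineM] at hzM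
    obtain ⟨h1, h2⟩ := hzL
    obtain ⟨h0, h2'⟩ := hzM
    rw [h0] at h2
    rw [h1] at h2'
    linear_combination h2' - h2
  · intro h
    exact ⟨meetPt x y, meetPt_mem_lineL x y, (meetPt_mem_lineM_iff x y).2 h⟩

/-- The key identity behind Lemma 2.1: `(U A + V + S B - W) · x₀ y₂ = x · y`. [cite:
deZeeuw2016, Lemma 2.1 (proof)] -/
theorem key_identity {x y : Fin 4 → K} (hx : x 0 ≠ 0) (hy : y 2 ≠ 0) :
    (cU x * cA y + cV x + cS y * cB x - cW y) * (x 0 * y 2) = x ⬝ᵥ y := by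
  simp only [cU, cA, cV, cS, cB, cW, dotProduct, Fin.sum_univ_four]
  field_simp
  ring

/-- `U A + V + S B = W` iff `x · y = 0`. [cite: deZeeuw2016, Lemma 2.1] -/
theorem cond_iff_dot {x y : Fin 4 → K} (hx : x 0 ≠ 0) (hy : y 2 ≠ 0) :
    cU x * cA y + cV x + cS y * cB x = cW y ↔ x ⬝ᵥ y = 0 := by
  rw [← key_identity hx hy, mul_eq_zero, sub_eq_zero, or_iff_left (mul_ne_zero hx hy)]

/-- **Lemma 2.1** (in coordinates): `φ(p) ∩ ψ(q) ≠ ∅ ⟺ x · y = 0` (`⟺ p ∈ q`). [cite: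
deZeeuw2016, Lemma 2.1] -/
theorem meet_iff_dot {x y : Fin 4 → K} (hx : x 0 ≠ 0) (hy : y 2 ≠ 0) :
    (∃ z, z ∈ lineL x ∧ z ∈ lineM y) ↔ x ⬝ᵥ y = 0 := by
  rw [meet_iff, cond_iff_dot hx hy]

/-- Distinct ratios from a nonzero minor. [folklore] -/
theorem div_ne_div_of_minor {a b c d : K} (hb : b ≠ 0) (hd : d ≠ 0) (h : a * d - b * c ≠ 0) :
    a / b ≠ c / d := by
  rw [Ne, div_eq_div_iff hb hd, ← sub_eq_zero]
  intro h'
  apply h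
  linear_combination h'

end Lines

/-! ### Polynomials of degree `≤ 2` in three variables; the quadric step -/

section Quadric

variable {K : Type*} [Field K]

/-- The exponent vector `(a, b, c)`. [folklore] -/
noncomputable def e3 (t : ℕ × ℕ × ℕ) : Fin 3 →₀ ℕ :=
  Finsupp.single 0 t.1 + Finsupp.single 1 t.2.1 + Finsupp.single 2 t.2.2

/-- Components of `e3`. [folklore] -/
@[simp] theorem e3_zero (t : ℕ × ℕ × ℕ) : e3 t 0 = t.1 := by simp [e3]

/-- Components of `e3`. [folklore] -/
@[simp] theorem e3_one (t : ℕ × ℕ × ℕ) : e3 t 1 = t.2.1 := by simp [e3]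

/-- Components of `e3`. [folklore] -/
@[simp] theorem e3_two (t : ℕ × ℕ × ℕ) : e3 t 2 = t.2.2 := by simp [e3]

/-- `e3` is injective. [folklore] -/
theorem e3_injective : Function.Injective e3 := by
  intro t t' h
  have h0 := congrArg (fun f => f 0) h
  have h1 := congrArg (fun f => f 1) h
  have h2 := congrArg (fun f => f 2) h
  simp only [e3_zero, e3_one, e3_two] at h0 h1 h2
  exact Prod.ext h0 (Prod.ext h1 h2)

/-- Every exponent vector is an `e3`. [folklore] -/
theorem eq_e3 (d : Fin 3 →₀ ℕ) : d = e3 (d 0, d 1, d 2) := by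
  ext i; fin_cases i <;> simp

/-- The exponent triples of degree `≤ 2`. [folklore] -/
def T10 : Finset (ℕ × ℕ × ℕ) :=
  ((range 3) ×ˢ ((range 3) ×ˢ (range 3))).filter fun t => t.1 + t.2.1 + t.2.2 ≤ 2

/-- The coefficient of `X₀^a X₁^b X₂^c`. [folklore] -/
noncomputable def cf (G : MvPolynomial (Fin 3) K) (a b c : ℕ) : K := coeff (e3 (a, b, c)) G

/-- The quadratic function carried by the ten low coefficients of `G`. [folklore] -/
noncomputable def qf (G : MvPolynomial (Fin 3) K) (z : Fin 3 → K) : K :=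
  cf G 2 0 0 * z 0 ^ 2 + cf G 0 2 0 * z 1 ^ 2 + cf G 0 0 2 * z 2 ^ 2
    + cf G 1 1 0 * z 0 * z 1 + cf G 1 0 1 * z 0 * z 2 + cf G 0 1 1 * z 1 * z 2
    + cf G 1 0 0 * z 0 + cf G 0 1 0 * z 1 + cf G 0 0 1 * z 2 + cf G 0 0 0

/-- A polynomial of total degree `≤ 2` in three variables is the quadratic function of its ten
low coefficients. [folklore] -/
theorem eval_eq_qf (G : MvPolynomial (Fin 3) K) (hG : G.totalDegree ≤ 2) (z : Fin 3 → K) :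
    eval z G = qf G z := by
  classical
  have hsupp : G.support ⊆ T10.image e3 := by
    intro d hd
    have hdeg := le_totalDegree hd
    rw [Finsupp.sum_fintype _ _ (by simp), Fin.sum_univ_three] at hdeg
    rw [mem_image]
    refine ⟨(d 0, d 1, d 2), ?_, (eq_e3 d).symm⟩
    simp only [T10, mem_filter, mem_product, mem_range]
    omega
  rw [eval_eq', sum_subset hsupp (fun d _ hd => by rw [notMem_support_iff.1 hd, zero_mul]),
    sum_image (fun t _ t' _ h => e3_injective h)]
  simp [T10, sum_filter, sum_product, sum_range_succ, Fin.prod_univ_three, cf, qf]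
  ring

/-- A polynomial of degree `≤ 2` whose ten low coefficients vanish is zero (over an infinite
field, by `MvPolynomial.funext`). [folklore] -/
theorem eq_zero_of_cf [Infinite K] (G : MvPolynomial (Fin 3) K) (hG : G.totalDegree ≤ 2)
    (h200 : cf G 2 0 0 = 0) (h020 : cf G 0 2 0 = 0) (h002 : cf G 0 0 2 = 0)
    (h110 : cf G 1 1 0 = 0) (h101 : cf G 1 0 1 = 0) (h011 : cf G 0 1 1 = 0)
    (h100 : cf G 1 0 0 = 0) (h010 : cf G 0 1 0 = 0) (h001 : cf G 0 0 1 = 0)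
    (h000 : cf G 0 0 0 = 0) : G = 0 :=
  MvPolynomial.funext fun z => by
    rw [eval_eq_qf G hG, map_zero, qf, h200, h020, h002, h110, h101, h011, h100, h010, h001, h000]
    ring

/-- A quadratic `c₂ u² + c₁ u + c₀` vanishing at three distinct points is zero. [folklore] -/
theorem quad_coeff_eq_zero {c₀ c₁ c₂ u₀ u₁ u₂ : K} (h01 : u₀ ≠ u₁) (h02 : u₀ ≠ u₂)
    (h12 : u₁ ≠ u₂) (e0 : c₂ * u₀ ^ 2 + c₁ * u₀ + c₀ = 0) (e1 : c₂ * u₁ ^ 2 + c₁ * u₁ + c₀ = 0)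
    (e2 : c₂ * u₂ ^ 2 + c₁ * u₂ + c₀ = 0) : c₂ = 0 ∧ c₁ = 0 ∧ c₀ = 0 := by
  have d1 : c₂ * (u₀ + u₁) + c₁ = 0 := by
    have : (u₀ - u₁) * (c₂ * (u₀ + u₁) + c₁) = 0 := by linear_combination e0 - e1
    exact (mul_eq_zero.1 this).resolve_left (sub_ne_zero.2 h01)
  have d2 : c₂ * (u₀ + u₂) + c₁ = 0 := by
    have : (u₀ - u₂) * (c₂ * (u₀ + u₂) + c₁) = 0 := by linear_combination e0 - e2
    exact (mul_eq_zero.1 this).resolve_left (sub_ne_zero.2 h02)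
  have hc2 : c₂ = 0 := by
    have : (u₁ - u₂) * c₂ = 0 := by linear_combination d1 - d2
    exact (mul_eq_zero.1 this).resolve_left (sub_ne_zero.2 h12)
  have hc1 : c₁ = 0 := by rw [hc2] at d1; linear_combination d1
  refine ⟨hc2, hc1, ?_⟩
  rw [hc2, hc1] at e0; linear_combination e0

/-- A quadratic vanishing identically on an infinite field is zero. [folklore] -/
theorem quad_coeff_eq_zero_of_forall [Infinite K] {c₀ c₁ c₂ : K}
    (h : ∀ u : K, c₂ * u ^ 2 + c₁ * u + c₀ = 0) : c₂ = 0 ∧ c₁ = 0 ∧ c₀ = 0 := by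
  classical
  obtain ⟨r, hr⟩ := Infinite.exists_notMem_finset ({0, 1} : Finset K)
  simp only [mem_insert, mem_singleton, not_or] at hr
  exact quad_coeff_eq_zero zero_ne_one (Ne.symm hr.1) (Ne.symm hr.2) (h 0) (h 1) (h r)

/-- Coefficient equations of a degree-`≤ 2` polynomial vanishing on a `φ`-line
`{(a, B, U a + V)}`. [folklore] -/
theorem coeffs_of_vanish_lineL [Infinite K] (G : MvPolynomial (Fin 3) K) (hG : G.totalDegree ≤ 2)
    {B U V : K} (hL : ∀ a, eval ![a, B, U * a + V] G = 0) :
    cf G 2 0 0 + cf G 1 0 1 * U + cf G 0 0 2 * U ^ 2 = 0 ∧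
      cf G 1 1 0 * B + cf G 1 0 1 * V + 2 * cf G 0 0 2 * U * V + cf G 0 1 1 * B * U
        + cf G 1 0 0 + cf G 0 0 1 * U = 0 ∧
      cf G 0 2 0 * B ^ 2 + cf G 0 0 2 * V ^ 2 + cf G 0 1 1 * B * V + cf G 0 1 0 * B
        + cf G 0 0 1 * V + cf G 0 0 0 = 0 :=
  quad_coeff_eq_zero_of_forall (K := K) fun a => by
    have := hL a
    rw [eval_eq_qf G hG] at this
    simp only [qf, Matrix.cons_val_zero, Matrix.cons_val_one, Matrix.head_cons,
      Matrix.cons_val_two, Matrix.tail_cons] at this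
    linear_combination this

/-- Coefficient equations of a degree-`≤ 2` polynomial vanishing on a `ψ`-line
`{(A, b, W - S b)}`. [folklore] -/
theorem coeffs_of_vanish_lineM [Infinite K] (G : MvPolynomial (Fin 3) K) (hG : G.totalDegree ≤ 2)
    {A S W : K} (hM : ∀ b, eval ![A, b, W - S * b] G = 0) :
    cf G 0 2 0 - cf G 0 1 1 * S + cf G 0 0 2 * S ^ 2 = 0 ∧
      cf G 1 1 0 * A - cf G 1 0 1 * A * S - 2 * cf G 0 0 2 * W * S + cf G 0 1 1 * W
        + cf G 0 1 0 - cf G 0 0 1 * S = 0 ∧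
      cf G 2 0 0 * A ^ 2 + cf G 0 0 2 * W ^ 2 + cf G 1 0 1 * A * W + cf G 1 0 0 * A
        + cf G 0 0 1 * W + cf G 0 0 0 = 0 :=
  quad_coeff_eq_zero_of_forall (K := K) fun b => by
    have := hM b
    rw [eval_eq_qf G hG] at this
    simp only [qf, Matrix.cons_val_zero, Matrix.cons_val_one, Matrix.head_cons,
      Matrix.cons_val_two, Matrix.tail_cons] at this
    linear_combination this

/-- **The quadric step** (classification-free replacement for the two-rulings argument in
de Zeeuw's proof of Theorem 4.1): a nonzero polynomial of degree `≤ 2` vanishing on three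
`φ`-lines `{(a, Bᵢ, Uᵢ a + Vᵢ)}` with distinct `Uᵢ` and `B₀ ≠ B₁`, and on two `ψ`-lines
`{(Aⱼ, b, Wⱼ - Sⱼ b)}` with `S₀ ≠ S₁`, has vanishing coefficients of `X₀², X₀X₂, X₂², X₁X₂, X₁²`
and a nonvanishing coefficient of `X₂` (else `G = 0`); consequently every `φ`-line on `{G = 0}`
meets every `ψ`-line on `{G = 0}` (in the point above `(A', B')`). [cite: deZeeuw2016, §4, proof
of Theorem 4.1 ("Suppose a quadric S contains the lines …")] -/
theorem quadric_meet [Infinite K] (G : MvPolynomial (Fin 3) K) (hG0 : G ≠ 0)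
    (hG : G.totalDegree ≤ 2) {B₀ U₀ V₀ B₁ U₁ V₁ B₂ U₂ V₂ : K} (hU01 : U₀ ≠ U₁) (hU02 : U₀ ≠ U₂)
    (hU12 : U₁ ≠ U₂) (hB01 : B₀ ≠ B₁) (hL0 : ∀ a, eval ![a, B₀, U₀ * a + V₀] G = 0)
    (hL1 : ∀ a, eval ![a, B₁, U₁ * a + V₁] G = 0) (hL2 : ∀ a, eval ![a, B₂, U₂ * a + V₂] G = 0)
    {A₀ S₀ W₀ A₁ S₁ W₁ : K} (hS : S₀ ≠ S₁) (hM0 : ∀ b, eval ![A₀, b, W₀ - S₀ * b] G = 0)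
    (hM1 : ∀ b, eval ![A₁, b, W₁ - S₁ * b] G = 0)
    {B' U' V' A' S' W' : K} (hL' : ∀ a, eval ![a, B', U' * a + V'] G = 0)
    (hM' : ∀ b, eval ![A', b, W' - S' * b] G = 0) :
    U' * A' + V' + S' * B' = W' := by
  have cL0 := coeffs_of_vanish_lineL G hG hL0
  have cL1 := coeffs_of_vanish_lineL G hG hL1
  have cL2 := coeffs_of_vanish_lineL G hG hL2
  have cM0 := coeffs_of_vanish_lineM G hG hM0
  have cM1 := coeffs_of_vanish_lineM G hG hM1
  -- `g200 = g101 = g002 = 0` from the three distinct slopes `Uᵢ`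
  obtain ⟨h002, h101, h200⟩ := quad_coeff_eq_zero (c₂ := cf G 0 0 2) (c₁ := cf G 1 0 1)
    (c₀ := cf G 2 0 0) hU01 hU02 hU12 (by linear_combination cL0.1)
    (by linear_combination cL1.1) (by linear_combination cL2.1)
  -- `g011 = g020 = 0` from the two distinct slopes `Sⱼ`
  have h011 : cf G 0 1 1 = 0 := by
    have e : (S₁ - S₀) * cf G 0 1 1 = 0 := by
      linear_combination cM0.1 - cM1.1 - (S₀ ^ 2 - S₁ ^ 2) * h002
    exact (mul_eq_zero.1 e).resolve_left (sub_ne_zero.2 hS.symm)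
  have h020 : cf G 0 2 0 = 0 := by
    linear_combination cM0.1 + S₀ * h011 - S₀ ^ 2 * h002
  -- the coefficient of `X₂` is nonzero, for otherwise `G = 0`
  have h001 : cf G 0 0 1 ≠ 0 := by
    intro h001
    have h110 : cf G 1 1 0 = 0 := by
      have e : (B₀ - B₁) * cf G 1 1 0 = 0 := by
        linear_combination cL0.2.1 - cL1.2.1 - (V₀ - V₁) * h101
          - 2 * (U₀ * V₀ - U₁ * V₁) * h002 - (B₀ * U₀ - B₁ * U₁) * h011
          - (U₀ - U₁) * h001
      exact (mul_eq_zero.1 e).resolve_left (sub_ne_zero.2 hB01)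
    have h100 : cf G 1 0 0 = 0 := by
      linear_combination cL0.2.1 - B₀ * h110 - V₀ * h101 - 2 * U₀ * V₀ * h002
        - B₀ * U₀ * h011 - U₀ * h001
    have h010 : cf G 0 1 0 = 0 := by
      linear_combination cM0.2.1 - A₀ * h110 + A₀ * S₀ * h101 + 2 * W₀ * S₀ * h002
        - W₀ * h011 + S₀ * h001
    have h000 : cf G 0 0 0 = 0 := by
      linear_combination cL0.2.2 - B₀ ^ 2 * h020 - V₀ ^ 2 * h002 - B₀ * V₀ * h011
        - B₀ * h010 - V₀ * h001
    exact hG0 (eq_zero_of_cf G hG h200 h020 h002 h110 h101 h011 h100 h010 h001 h000)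
  -- the points of `ℓ'` and `m'` above `(A', B')` have the same height
  have e1 := hL' A'
  have e2 := hM' B'
  rw [eval_eq_qf G hG] at e1 e2
  simp only [qf, Matrix.cons_val_zero, Matrix.cons_val_one, Matrix.head_cons,
    Matrix.cons_val_two, Matrix.tail_cons, h020, h011] at e1 e2
  have e : cf G 0 0 1 * (U' * A' + V' + S' * B' - W') = 0 := by
    linear_combination e1 - e2 - (A' * (U' * A' + V') - A' * (W' - S' * B')) * h101
      - ((U' * A' + V') ^ 2 - (W' - S' * B') ^ 2) * h002
  exact sub_eq_zero.1 ((mul_eq_zero.1 e).resolve_left h001)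

end Quadric

/-! ### Planes of `𝔽³`: equations, and collinearity of points on two planes -/

section Planes

variable {F : Type*} [Field F]

/-- Every plane of `𝔽³` (affine subspace with direction of rank `2`) has an equation
`n · z = δ` with `n ≠ 0`. [folklore] -/
theorem exists_equation_of_finrank_eq_two (q : AffineSubspace F (Fin 3 → F))
    (hq : Module.finrank F q.direction = 2) :
    ∃ (n : Fin 3 → F) (δ : F), n ≠ 0 ∧ ∀ z : Fin 3 → F, z ∈ q ↔ n ⬝ᵥ z = δ := by
  -- `q` is nonempty
  have hne : (q : Set (Fin 3 → F)).Nonempty := by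
    rw [AffineSubspace.nonempty_iff_ne_bot]
    intro hbot
    rw [hbot, AffineSubspace.direction_bot, finrank_bot] at hq
    omega
  obtain ⟨z₀, hz₀⟩ := hne
  -- a nonzero functional vanishing on the direction
  have hlt : q.direction < ⊤ := by
    refine lt_top_iff_ne_top.2 fun htop => ?_
    have := congrArg (fun S : Submodule F (Fin 3 → F) => Module.finrank F S) htop
    simp only [finrank_top, Module.finrank_fin_fun, hq] at this
    omega
  obtain ⟨f, hf0, hle⟩ := Submodule.exists_le_ker_of_lt_top _ hlt
  -- the direction is exactly the kernel
  have hker : Module.finrank F (LinearMap.ker f) = 2 := by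
    have h1 := LinearMap.finrank_range_add_finrank_ker f
    rw [Module.finrank_fin_fun] at h1
    have hr : Module.finrank F (LinearMap.range f) = 1 := by
      have hle1 : Module.finrank F (LinearMap.range f) ≤ 1 :=
        (Submodule.finrank_le _).trans (by simp)
      have hpos : 0 < Module.finrank F (LinearMap.range f) := by
        rw [Module.finrank_pos_iff_exists_ne_zero]
        obtain ⟨v, hv⟩ : ∃ v, f v ≠ 0 := by
          by_contra h; push Not at h; exact hf0 (LinearMap.ext h)
        exact ⟨⟨f v, LinearMap.mem_range_self f v⟩, by simpa [Subtype.ext_iff] using hv⟩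
      omega
    omega
  have hdir : q.direction = LinearMap.ker f :=
    Submodule.eq_of_le_of_finrank_eq hle (hq.trans hker.symm)
  -- coordinates of `f`
  set n : Fin 3 → F := fun i => f (Pi.single i 1) with hn
  have hf : ∀ z : Fin 3 → F, f z = n ⬝ᵥ z := by
    intro z
    rw [LinearMap.pi_apply_eq_sum_univ f z]
    simp only [dotProduct, hn, smul_eq_mul]
    refine Finset.sum_congr rfl fun i _ => ?_
    rw [mul_comm]
    congr 1
    congr 1
    ext j
    simp [Pi.single_apply, eq_comm]
  refine ⟨n, f z₀, ?_, fun z => ?_⟩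
  · intro hn0
    apply hf0
    apply LinearMap.ext
    intro z
    rw [hf z, hn0]
    simp
  · rw [← AffineSubspace.vsub_right_mem_direction_iff_mem hz₀ z, hdir, LinearMap.mem_ker,
      vsub_eq_sub, map_sub, sub_eq_zero, hf z]

/-- Points lying on two distinct planes of `𝔽³` are collinear: they lie on one line (an affine
subspace with direction of rank `1`). [folklore] -/
theorem exists_line_of_two_planes {q₁ q₂ : AffineSubspace F (Fin 3 → F)}
    (h₁ : Module.finrank F q₁.direction = 2) (h₂ : Module.finrank F q₂.direction = 2)
    (hne : q₁ ≠ q₂) {p₀ p₁ : Fin 3 → F} (hp : p₀ ≠ p₁)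
    (hp₀₁ : p₀ ∈ q₁) (hp₀₂ : p₀ ∈ q₂) (hp₁₁ : p₁ ∈ q₁) (hp₁₂ : p₁ ∈ q₂) :
    ∃ ℓ : AffineSubspace F (Fin 3 → F), Module.finrank F ℓ.direction = 1 ∧
      ∀ p, p ∈ q₁ → p ∈ q₂ → p ∈ ℓ := by
  have hv : p₁ -ᵥ p₀ ≠ 0 := fun h => hp (eq_of_vsub_eq_zero h).symm
  refine ⟨AffineSubspace.mk' p₀ (F ∙ (p₁ -ᵥ p₀)), ?_, fun p hp1 hp2 => ?_⟩
  · rw [AffineSubspace.direction_mk']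
    exact finrank_span_singleton hv
  · -- the intersection of the two directions has rank `1`
    set D := q₁.direction ⊓ q₂.direction with hD
    have hD2 : Module.finrank F D ≠ 2 := by
      intro hD2
      have e1 : D = q₁.direction :=
        Submodule.eq_of_le_of_finrank_eq inf_le_left (hD2.trans h₁.symm)
      have e2 : D = q₂.direction :=
        Submodule.eq_of_le_of_finrank_eq inf_le_right (hD2.trans h₂.symm)
      exact hne (AffineSubspace.ext_of_direction_eq (e1.symm.trans e2) ⟨p₀, hp₀₁, hp₀₂⟩)
    have hDle : Module.finrank F D ≤ 2 := h₁ ▸ Submodule.finrank_mono inf_le_left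
    have hvD : p₁ -ᵥ p₀ ∈ D :=
      ⟨AffineSubspace.vsub_mem_direction hp₁₁ hp₀₁, AffineSubspace.vsub_mem_direction hp₁₂ hp₀₂⟩
    have hD1 : 1 ≤ Module.finrank F D := by
      rw [Nat.one_le_iff_ne_zero, Ne, Submodule.finrank_eq_zero]
      intro hbot
      rw [hbot] at hvD
      exact hv ((Submodule.mem_bot F).1 hvD)
    have hDeq : Module.finrank F D = 1 := by omega
    have hwD : p -ᵥ p₀ ∈ D :=
      ⟨AffineSubspace.vsub_mem_direction hp1 hp₀₁, AffineSubspace.vsub_mem_direction hp2 hp₀₂⟩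
    obtain ⟨c, hc⟩ := (finrank_eq_one_iff_of_nonzero' (⟨p₁ -ᵥ p₀, hvD⟩ : D)
      (by simpa [Subtype.ext_iff] using hv)).1 hDeq ⟨p -ᵥ p₀, hwD⟩
    rw [AffineSubspace.mem_mk', Submodule.mem_span_singleton]
    exact ⟨c, by simpa [Subtype.ext_iff] using hc⟩

/-- Two distinct points of `𝔽³` lie on a line. [folklore] -/
theorem exists_line_through {p₀ p₁ : Fin 3 → F} (hp : p₀ ≠ p₁) :
    ∃ ℓ : AffineSubspace F (Fin 3 → F), Module.finrank F ℓ.direction = 1 ∧ p₀ ∈ ℓ ∧ p₁ ∈ ℓ := by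
  have hv : p₁ -ᵥ p₀ ≠ 0 := fun h => hp (eq_of_vsub_eq_zero h).symm
  refine ⟨AffineSubspace.mk' p₀ (F ∙ (p₁ -ᵥ p₀)), ?_, AffineSubspace.self_mem_mk' _ _, ?_⟩
  · rw [AffineSubspace.direction_mk']
    exact finrank_span_singleton hv
  · rw [AffineSubspace.mem_mk']
    exact Submodule.mem_span_singleton_self _

end Planes

/-! ### Homogeneous coordinates of points and planes -/

section Homogeneous

variable {F : Type*} [Field F]

/-- Homogeneous coordinates `p̂ = (p, 1)` of a point of `𝔽³`. [folklore] -/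
def phF (p : Fin 3 → F) : Fin 4 → F := ![p 0, p 1, p 2, 1]

/-- Homogeneous coordinates `q̂ = (n, -δ)` of the plane `n · z = δ`. [folklore] -/
def qhF (n : Fin 3 → F) (δ : F) : Fin 4 → F := ![n 0, n 1, n 2, -δ]

/-- `p̂ · q̂ = n · p - δ`, so that `p ∈ q ⟺ p̂ · q̂ = 0`. [folklore] -/
theorem phF_dotProduct_qhF (p n : Fin 3 → F) (δ : F) : phF p ⬝ᵥ qhF n δ = n ⬝ᵥ p - δ := by
  simp [phF, qhF, dotProduct, Fin.sum_univ_four, Fin.sum_univ_three]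
  ring

/-- `p̂` has last coordinate `1`. [folklore] -/
@[simp] theorem phF_three (p : Fin 3 → F) : phF p 3 = 1 := rfl

/-- `p̂` extends `p`. [folklore] -/
@[simp] theorem phF_castSucc (p : Fin 3 → F) (i : Fin 3) : phF p (Fin.castSucc i) = p i := by
  fin_cases i <;> rfl

/-- `q̂` has last coordinate `-δ`. [folklore] -/
@[simp] theorem qhF_three (n : Fin 3 → F) (δ : F) : qhF n δ 3 = -δ := rfl

/-- `q̂` extends `n`. [folklore] -/
@[simp] theorem qhF_castSucc (n : Fin 3 → F) (δ : F) (i : Fin 3) :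
    qhF n δ (Fin.castSucc i) = n i := by
  fin_cases i <;> rfl

variable {K : Type*} [Field K] (ι : F →+* K)

/-- `p̂ ≠ 0` (in `K⁴`). [folklore] -/
theorem ph_ne_zero (p : Fin 3 → F) : (fun k => ι (phF p k)) ≠ 0 := fun h => by
  simpa using congr_fun h 3

/-- Distinct points have non-proportional homogeneous coordinates (a nonzero `2 × 2` minor).
[folklore] -/
theorem ph_minor {p p' : Fin 3 → F} (h : p ≠ p') :
    ∃ k l, ι (phF p k) * ι (phF p' l) - ι (phF p l) * ι (phF p' k) ≠ 0 := by
  obtain ⟨i, hi⟩ := Function.ne_iff.1 h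
  refine ⟨Fin.castSucc i, 3, ?_⟩
  simp only [phF_castSucc, phF_three, map_one, mul_one, one_mul]
  rwa [sub_ne_zero, ι.injective.ne_iff]

/-- `p ↦ p̂` is injective. [folklore] -/
theorem ph_injective : Function.Injective fun (p : Fin 3 → F) (k : Fin 4) => ι (phF p k) := by
  intro p p' h
  funext i
  have := congr_fun h (Fin.castSucc i)
  simpa [ι.injective.eq_iff] using this

/-- `q̂ ≠ 0` for `n ≠ 0`. [folklore] -/
theorem qh_ne_zero {n : Fin 3 → F} (hn : n ≠ 0) (δ : F) : (fun k => ι (qhF n δ k)) ≠ 0 := by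
  obtain ⟨i, hi⟩ := Function.ne_iff.1 hn
  intro h
  have := congr_fun h (Fin.castSucc i)
  simp only [qhF_castSucc, Pi.zero_apply, map_eq_zero_iff ι ι.injective] at this
  exact hi this

/-- Planes (with nonzero normals) having different point sets have non-proportional
homogeneous coordinates (a nonzero `2 × 2` minor). [folklore] -/
theorem qh_minor {n n' : Fin 3 → F} {δ δ' : F} (hn : n ≠ 0) (hn' : n' ≠ 0)
    (hne : ¬ ∀ z : Fin 3 → F, (n ⬝ᵥ z = δ ↔ n' ⬝ᵥ z = δ')) :
    ∃ k l, ι (qhF n δ k) * ι (qhF n' δ' l) - ι (qhF n δ l) * ι (qhF n' δ' k) ≠ 0 := by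
  by_contra hall
  push Not at hall
  have hallF : ∀ k l, qhF n δ k * qhF n' δ' l = qhF n δ l * qhF n' δ' k := fun k l => by
    have := hall k l
    rwa [sub_eq_zero, ← map_mul, ← map_mul, ι.injective.eq_iff] at this
  obtain ⟨i, hi⟩ := Function.ne_iff.1 hn
  have hi' : n i ≠ 0 := by simpa using hi
  set c : F := n' i / n i with hc
  have hnj : ∀ j, n' j = c * n j := fun j => by
    have := hallF (Fin.castSucc i) (Fin.castSucc j)
    simp only [qhF_castSucc] at this
    rw [hc]
    field_simp
    linear_combination this
  have hδ' : δ' = c * δ := by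
    have := hallF (Fin.castSucc i) 3
    simp only [qhF_castSucc, qhF_three] at this
    rw [hc]
    field_simp
    linear_combination -this
  have hc0 : c ≠ 0 := by
    intro hc0
    apply hn'
    funext j
    rw [hnj j, hc0, zero_mul, Pi.zero_apply]
  apply hne
  intro z
  have hdot : n' ⬝ᵥ z = c * (n ⬝ᵥ z) := by
    simp only [dotProduct, hnj, mul_assoc, ← Finset.mul_sum]
  rw [hdot, hδ']
  constructor
  · intro h; rw [h]
  · intro h; exact mul_left_cancel₀ hc0 h

end Homogeneous

/-! ### Vanishing along the two line families -/

section Vanish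

variable {K : Type*} [Field K]

/-- A polynomial vanishing on `lineL x` vanishes at `(a, B, U a + V)`. [folklore] -/
theorem vanish_lineL {G : MvPolynomial (Fin 3) K} {x : Fin 4 → K}
    (h : ∀ z ∈ lineL x, eval z G = 0) (a : K) : eval ![a, cB x, cU x * a + cV x] G = 0 :=
  h _ (by rw [mem_lineL]; simp)

/-- A polynomial vanishing on `lineM y` vanishes at `(A, b, W - S b)`. [folklore] -/
theorem vanish_lineM {G : MvPolynomial (Fin 3) K} {y : Fin 4 → K}
    (h : ∀ z ∈ lineM y, eval z G = 0) (b : K) : eval ![cA y, b, cW y - cS y * b] G = 0 :=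
  h _ (by rw [mem_lineM]; simp)

end Vanish

/-! ### The main case: `k ≥ 2`, over an infinite field `K ⊇ 𝔽` -/

section MainCase

open scoped Classical in
/-- **de Zeeuw's proof of Theorem 4.1, main case.** Given the conclusion of Lemma 3.1 over an
infinite field `K` (with constant `C_H`), a field `𝔽` with a ring map `ι : 𝔽 → K` and the same
characteristic, finite sets `P` of points and `Q` of planes of `𝔽³` with `|P| ≤ |Q|`, the
characteristic proviso, and at most `k ≥ 2` points of `P` on any line: `I(P, Q) ≤
C_H (|P|^{1/2}|Q| + (k+1)|P| + (k+1)|Q|)`. The proof builds `L = φ(P)`, `M = ψ(Q)` after a generic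
projective transformation and applies Lemma 3.1 with `s = t = k + 1`.
[cite: deZeeuw2016, §4, proof of Theorem 4.1] -/
theorem card_incidences_le_of_lineIntersection {CH c₀ : ℝ} (K : Type) [Field K] [Infinite K]
    (hH : ∀ (L M : Finset (AffineSubspace K (Fin 3 → K))) (s t : ℕ),
        (∀ ℓ ∈ L, Module.finrank K ℓ.direction = 1) →
        (∀ m ∈ M, Module.finrank K m.direction = 1) →
        Disjoint L M →
        L.card ≤ M.card →
        (ringChar K = 0 ∨ (L.card : ℝ) ≤ c₀ * (ringChar K : ℝ) ^ 2) →
        (∀ G : MvPolynomial (Fin 3) K, G ≠ 0 → G.totalDegree ≤ 2 →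
          (L.filter fun ℓ => ∀ z ∈ ℓ, MvPolynomial.eval z G = 0).card < s ∨
          (M.filter fun m => ∀ z ∈ m, MvPolynomial.eval z G = 0).card < t) →
        ∀ I : Finset (Fin 3 → K),
          (∀ z ∈ I, (∃ ℓ ∈ L, z ∈ ℓ) ∧ (∃ m ∈ M, z ∈ m)) →
          (I.card : ℝ) ≤ CH * ((L.card : ℝ) ^ (1 / 2 : ℝ) * (M.card : ℝ)
            + (t : ℝ) * (L.card : ℝ) + (s : ℝ) * (M.card : ℝ)))
    {F : Type} [Field F] (ι : F →+* K) (hcharK : ringChar K = ringChar F)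
    (P : Finset (Fin 3 → F)) (Q : Finset (AffineSubspace F (Fin 3 → F))) (k : ℕ)
    (hQ : ∀ π ∈ Q, Module.finrank F π.direction = 2) (hPQ : P.card ≤ Q.card)
    (hchar : ringChar F = 0 ∨ (P.card : ℝ) ≤ c₀ * (ringChar F : ℝ) ^ 2)
    (hk : ∀ ℓ : AffineSubspace F (Fin 3 → F), Module.finrank F ℓ.direction = 1 →
      (P.filter fun q => q ∈ ℓ).card ≤ k)
    (hk2 : 2 ≤ k) :
    (((P ×ˢ Q).filter fun i => i.1 ∈ i.2).card : ℝ) ≤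
      CH * ((P.card : ℝ) ^ (1 / 2 : ℝ) * (Q.card : ℝ) + ((k : ℝ) + 1) * (P.card : ℝ)
        + ((k : ℝ) + 1) * (Q.card : ℝ)) := by
  set Ip := (P ×ˢ Q).filter fun i => i.1 ∈ i.2 with hIp
  have hι : Function.Injective ι := ι.injective
  -- equations of the planes of `Q`
  have heq : ∀ q ∈ Q, ∃ nd : (Fin 3 → F) × F, nd.1 ≠ 0 ∧ ∀ z, z ∈ q ↔ nd.1 ⬝ᵥ z = nd.2 := by
    intro q hq
    obtain ⟨n, δ, hn, h⟩ := exists_equation_of_finrank_eq_two q (hQ q hq)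
    exact ⟨(n, δ), hn, h⟩
  choose! nd hnd hmem using heq
  -- homogeneous coordinates in `K⁴`
  set vh : (Fin 3 → F) → Fin 4 → K := fun p k => ι (phF p k) with hvh
  set wh : AffineSubspace F (Fin 3 → F) → Fin 4 → K :=
    fun q k => ι (qhF (nd q).1 (nd q).2 k) with hwh
  have hinc : ∀ p, ∀ q ∈ Q, (p ∈ q ↔ vh p ⬝ᵥ wh q = 0) := by
    intro p q hq
    have hd : vh p ⬝ᵥ wh q = ι (phF p ⬝ᵥ qhF (nd q).1 (nd q).2) :=
      (RingHom.map_dotProduct ι (phF p) (qhF (nd q).1 (nd q).2)).symm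
    rw [hmem q hq, hd, phF_dotProduct_qhF, map_eq_zero_iff ι hι, sub_eq_zero]
  have hvh_inj : ∀ p p', vh p = vh p' → p = p' := fun p p' h => ph_injective ι h
  have hwh_ne : ∀ q ∈ Q, ∀ q' ∈ Q, q ≠ q' →
      ∃ k l, wh q k * wh q' l - wh q l * wh q' k ≠ 0 := by
    intro q hq q' hq' hne
    refine qh_minor ι (hnd q hq) (hnd q' hq') fun hall => hne (SetLike.ext fun z => ?_)
    rw [hmem q hq, hmem q' hq']
    exact hall z
  -- the generic projective transformation
  obtain ⟨g, hdet, hx0, hx30, hx10, hy2, hy12, hy32⟩ :=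
    exists_generic (P.image vh) (Q.image wh)
      (by
        simp only [mem_image]
        rintro _ ⟨p, -, rfl⟩
        exact ph_ne_zero ι p)
      (by
        simp only [mem_image]
        rintro _ ⟨p, -, rfl⟩ _ ⟨p', -, rfl⟩ hne
        exact ph_minor ι fun h => hne (by rw [h]))
      (by
        simp only [mem_image]
        rintro _ ⟨q, hq, rfl⟩
        exact qh_ne_zero ι (hnd q hq) _)
      (by
        simp only [mem_image]
        rintro _ ⟨q, hq, rfl⟩ _ ⟨q', hq', rfl⟩ hne
        exact hwh_ne q hq q' hq' fun h => hne (by rw [h]))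
  set x : (Fin 3 → F) → Fin 4 → K := fun p => g *ᵥ vh p with hx
  set y : AffineSubspace F (Fin 3 → F) → Fin 4 → K := fun q => (g.adjugate)ᵀ *ᵥ wh q with hy
  have hx0' : ∀ p ∈ P, x p 0 ≠ 0 := fun p hp => hx0 _ (mem_image_of_mem _ hp)
  have hy2' : ∀ q ∈ Q, y q 2 ≠ 0 := fun q hq => hy2 _ (mem_image_of_mem _ hq)
  have hU : ∀ p ∈ P, ∀ p' ∈ P, p ≠ p' → cU (x p) ≠ cU (x p') := by
    intro p hp p' hp' hne h
    have hne' : vh p ≠ vh p' := fun h => hne (hvh_inj p p' h)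
    have := div_ne_div_of_minor (hx0' p hp) (hx0' p' hp')
      (hx30 _ (mem_image_of_mem _ hp) _ (mem_image_of_mem _ hp') hne')
    exact this (sub_right_injective h)
  have hB : ∀ p ∈ P, ∀ p' ∈ P, p ≠ p' → cB (x p) ≠ cB (x p') := by
    intro p hp p' hp' hne
    have hne' : vh p ≠ vh p' := fun h => hne (hvh_inj p p' h)
    exact div_ne_div_of_minor (hx0' p hp) (hx0' p' hp')
      (hx10 _ (mem_image_of_mem _ hp) _ (mem_image_of_mem _ hp') hne')
  have hwh_ne' : ∀ q ∈ Q, ∀ q' ∈ Q, q ≠ q' → wh q ≠ wh q' := by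
    intro q hq q' hq' hne h
    obtain ⟨k', l, hkl⟩ := hwh_ne q hq q' hq' hne
    rw [h] at hkl
    exact hkl (by ring)
  have hS : ∀ q ∈ Q, ∀ q' ∈ Q, q ≠ q' → cS (y q) ≠ cS (y q') := by
    intro q hq q' hq' hne
    exact div_ne_div_of_minor (hy2' q hq) (hy2' q' hq')
      (hy12 _ (mem_image_of_mem _ hq) _ (mem_image_of_mem _ hq') (hwh_ne' q hq q' hq' hne))
  have hA : ∀ q ∈ Q, ∀ q' ∈ Q, q ≠ q' → cA (y q) ≠ cA (y q') := by
    intro q hq q' hq' hne h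
    have := div_ne_div_of_minor (hy2' q hq) (hy2' q' hq')
      (hy32 _ (mem_image_of_mem _ hq) _ (mem_image_of_mem _ hq') (hwh_ne' q hq q' hq' hne))
    apply this
    simp only [cA, neg_div] at h
    exact neg_injective h
  -- Lemma 2.1: incidence ⟺ the meeting condition
  have hcond : ∀ p ∈ P, ∀ q ∈ Q,
      (p ∈ q ↔ cU (x p) * cA (y q) + cV (x p) + cS (y q) * cB (x p) = cW (y q)) := by
    intro p hp q hq
    rw [cond_iff_dot (hx0' p hp) (hy2' q hq), hinc p q hq, hx, hy]
    simp only [mulVec_dotProduct_adjugate, mul_eq_zero, or_iff_right hdet]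
  -- the two line families
  set L : Finset (AffineSubspace K (Fin 3 → K)) := P.image fun p => lineL (x p) with hL
  set M : Finset (AffineSubspace K (Fin 3 → K)) := Q.image fun q => lineM (y q) with hM
  have hLcard : L.card = P.card := by
    refine card_image_of_injOn fun p hp p' hp' h => ?_
    by_contra hne
    exact hB p hp p' hp' hne (cB_eq_of_lineL_eq h)
  have hMcard : M.card = Q.card := by
    refine card_image_of_injOn fun q hq q' hq' h => ?_
    by_contra hne
    exact hA q hq q' hq' hne (cA_eq_of_lineM_eq h)
  have hL1 : ∀ ℓ ∈ L, Module.finrank K ℓ.direction = 1 := by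
    simp only [hL, mem_image]
    rintro _ ⟨p, -, rfl⟩
    exact finrank_direction_lineL _
  have hM1 : ∀ m ∈ M, Module.finrank K m.direction = 1 := by
    simp only [hM, mem_image]
    rintro _ ⟨q, -, rfl⟩
    exact finrank_direction_lineM _
  have hdisj : Disjoint L M := by
    rw [disjoint_left]
    intro ℓ hℓ hℓM
    simp only [hL, hM, mem_image] at hℓ hℓM
    obtain ⟨p, -, rfl⟩ := hℓ
    obtain ⟨q, -, h⟩ := hℓM
    exact lineL_ne_lineM _ _ h.symm
  have hLM : L.card ≤ M.card := by rw [hLcard, hMcard]; exact hPQ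
  have hcharL : ringChar K = 0 ∨ (L.card : ℝ) ≤ c₀ * (ringChar K : ℝ) ^ 2 := by
    rw [hcharK, hLcard]; exact hchar
  -- §4: no quadric contains `k + 1` lines of `L` and `k + 1` lines of `M`
  have hquad : ∀ G : MvPolynomial (Fin 3) K, G ≠ 0 → G.totalDegree ≤ 2 →
      (L.filter fun ℓ => ∀ z ∈ ℓ, MvPolynomial.eval z G = 0).card < k + 1 ∨
      (M.filter fun m => ∀ z ∈ m, MvPolynomial.eval z G = 0).card < k + 1 := by
    intro G hG0 hG
    by_contra hcon
    rw [not_or, not_lt, not_lt] at hcon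
    obtain ⟨hLk, hMk⟩ := hcon
    set PL := P.filter fun p => ∀ z ∈ lineL (x p), MvPolynomial.eval z G = 0 with hPL
    set QM := Q.filter fun q => ∀ z ∈ lineM (y q), MvPolynomial.eval z G = 0 with hQM
    have hPLcard : k + 1 ≤ PL.card := by
      refine hLk.trans ?_
      rw [hL, Finset.filter_image]
      exact card_image_le
    have hQMcard : k + 1 ≤ QM.card := by
      refine hMk.trans ?_
      rw [hM, Finset.filter_image]
      exact card_image_le
    obtain ⟨p₀, p₁, p₂, hp₀, hp₁, hp₂, h01, h02, h12⟩ :=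
      two_lt_card_iff.1 (show 2 < PL.card by omega)
    obtain ⟨q₀, q₁, hq₀, hq₁, hq01⟩ := one_lt_card_iff.1 (show 1 < QM.card by omega)
    have hPL' : ∀ p ∈ PL, p ∈ P ∧ ∀ z ∈ lineL (x p), MvPolynomial.eval z G = 0 :=
      fun p hp => by simpa [hPL] using hp
    have hQM' : ∀ q ∈ QM, q ∈ Q ∧ ∀ z ∈ lineM (y q), MvPolynomial.eval z G = 0 :=
      fun q hq => by simpa [hQM] using hq
    -- every point of `PL` lies on every plane of `QM`
    have hall : ∀ p ∈ PL, ∀ q ∈ QM, p ∈ q := by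
      intro p hp q hq
      rw [hcond p (hPL' p hp).1 q (hQM' q hq).1]
      exact quadric_meet G hG0 hG
        (hU p₀ (hPL' p₀ hp₀).1 p₁ (hPL' p₁ hp₁).1 h01)
        (hU p₀ (hPL' p₀ hp₀).1 p₂ (hPL' p₂ hp₂).1 h02)
        (hU p₁ (hPL' p₁ hp₁).1 p₂ (hPL' p₂ hp₂).1 h12)
        (hB p₀ (hPL' p₀ hp₀).1 p₁ (hPL' p₁ hp₁).1 h01)
        (vanish_lineL (hPL' p₀ hp₀).2) (vanish_lineL (hPL' p₁ hp₁).2)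
        (vanish_lineL (hPL' p₂ hp₂).2)
        (hS q₀ (hQM' q₀ hq₀).1 q₁ (hQM' q₁ hq₁).1 hq01)
        (vanish_lineM (hQM' q₀ hq₀).2) (vanish_lineM (hQM' q₁ hq₁).2)
        (vanish_lineL (hPL' p hp).2) (vanish_lineM (hQM' q hq).2)
    -- hence `k + 1` collinear points of `P`
    obtain ⟨ℓ, hℓ, hℓmem⟩ := exists_line_of_two_planes (hQ q₀ (hQM' q₀ hq₀).1)
      (hQ q₁ (hQM' q₁ hq₁).1) hq01 h01 (hall p₀ hp₀ q₀ hq₀) (hall p₀ hp₀ q₁ hq₁)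
      (hall p₁ hp₁ q₀ hq₀) (hall p₁ hp₁ q₁ hq₁)
    have hsub : PL ⊆ P.filter fun q => q ∈ ℓ := fun p hp =>
      mem_filter.2 ⟨(hPL' p hp).1, hℓmem p (hall p hp q₀ hq₀) (hall p hp q₁ hq₁)⟩
    have h1 := hk ℓ hℓ
    have h2 := card_le_card hsub
    omega
  -- incidences inject into intersection points
  set I : Finset (Fin 3 → K) := Ip.image fun i => meetPt (x i.1) (y i.2) with hIdef
  have hIcard : I.card = Ip.card := by
    refine card_image_of_injOn ?_
    rintro ⟨p, q⟩ hpq ⟨p', q'⟩ hpq' h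
    simp only [mem_coe, hIp, mem_filter, mem_product] at hpq hpq'
    have hA' : cA (y q) = cA (y q') := by simpa [meetPt] using congr_fun h 0
    have hB' : cB (x p) = cB (x p') := by simpa [meetPt] using congr_fun h 1
    have hpp : p = p' := by
      by_contra hne
      exact hB p hpq.1.1 p' hpq'.1.1 hne hB'
    have hqq : q = q' := by
      by_contra hne
      exact hA q hpq.1.2 q' hpq'.1.2 hne hA'
    rw [hpp, hqq]
  have hI : ∀ z ∈ I, (∃ ℓ ∈ L, z ∈ ℓ) ∧ (∃ m ∈ M, z ∈ m) := by
    intro z hz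
    obtain ⟨⟨p, q⟩, hpq, rfl⟩ := mem_image.1 hz
    simp only [hIp, mem_filter, mem_product] at hpq
    obtain ⟨⟨hp, hq⟩, hpin⟩ := hpq
    exact ⟨⟨lineL (x p), mem_image_of_mem _ hp, meetPt_mem_lineL _ _⟩,
      ⟨lineM (y q), mem_image_of_mem _ hq,
        (meetPt_mem_lineM_iff _ _).2 ((hcond p hp q hq).1 hpin)⟩⟩
  -- apply Lemma 3.1
  have hmain := hH L M (k + 1) (k + 1) hL1 hM1 hdisj hLM hcharL hquad I hI
  rw [hIcard, hLcard, hMcard] at hmain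
  push_cast at hmain
  linarith [hmain]

end MainCase

end DeZeeuw

/-! ### The main theorem -/

open DeZeeuw in
open scoped Classical in
/-- **Rudnev's point–plane incidence theorem from the bipartite Guth–Katz line bound over
algebraically closed fields** (de Zeeuw 2016, §2 and §4: Theorem 1.1 deduced from Lemma 3.1).
The hypothesis `H` is [deZeeuw2016, Lemma 3.1] as printed (see the module docstring for the
rendering), required ONLY for algebraically closed fields `K` — which is all the printed proof
uses ("we can pass to any infinite extension of `𝔽`"; here `K = AlgebraicClosure 𝔽`) and is the
setting of Kollár's theory of lines on surfaces [Kollar2015, §7: "we work over an algebraically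
closed field"]: for every `c₀ > 0` there is `C > 0` such that for every algebraically closed field
`K`, all finite disjoint sets `L, M` of lines of `K³` with `|L| ≤ |M|`, `|L| ≤ c₀ p²` in positive
characteristic `p`, and all `s, t` such that no nonzero polynomial of degree `≤ 2` vanishes on `s`
lines of `L` and `t` lines of `M`, every finite set of points each lying on a line of `L` and on
a line of `M` has at most `C (|L|^{1/2}|M| + t|L| + s|M|)` elements. The conclusion is Rudnev's
theorem in the point form of [deZeeuw2016, Theorem 1.1] = [StevensDeZeeuw2017, Theorem 6],
verbatim the hypothesis of `stevensDeZeeuw_thm4_of_pointPlane`, with `C = 4 C_H(c₀) + 1`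
(the cases `k ≤ 1` are trivial).
[cite: deZeeuw2016, Theorem 1.1, Lemma 2.1 and §4 (proof of Theorem 4.1); hypothesis = Lemma 3.1] -/
theorem rudnev_pointPlaneIncidence_of_lineIntersection_closed
    (H : ∀ c₀ : ℝ, 0 < c₀ → ∃ C : ℝ, 0 < C ∧
      ∀ (K : Type) [Field K] [IsAlgClosed K] (L M : Finset (AffineSubspace K (Fin 3 → K)))
        (s t : ℕ),
        (∀ ℓ ∈ L, Module.finrank K ℓ.direction = 1) →
        (∀ m ∈ M, Module.finrank K m.direction = 1) →
        Disjoint L M →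
        L.card ≤ M.card →
        (ringChar K = 0 ∨ (L.card : ℝ) ≤ c₀ * (ringChar K : ℝ) ^ 2) →
        (∀ G : MvPolynomial (Fin 3) K, G ≠ 0 → G.totalDegree ≤ 2 →
          (L.filter fun ℓ => ∀ z ∈ ℓ, MvPolynomial.eval z G = 0).card < s ∨
          (M.filter fun m => ∀ z ∈ m, MvPolynomial.eval z G = 0).card < t) →
        ∀ I : Finset (Fin 3 → K),
          (∀ z ∈ I, (∃ ℓ ∈ L, z ∈ ℓ) ∧ (∃ m ∈ M, z ∈ m)) →
          (I.card : ℝ) ≤ C * ((L.card : ℝ) ^ (1 / 2 : ℝ) * (M.card : ℝ)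
            + (t : ℝ) * (L.card : ℝ) + (s : ℝ) * (M.card : ℝ))) :
    ∀ c₀ : ℝ, 0 < c₀ → ∃ C : ℝ, 0 < C ∧
      ∀ (F : Type) [Field F] (P : Finset (Fin 3 → F)) (Q : Finset (AffineSubspace F (Fin 3 → F)))
        (k : ℕ),
        (∀ π ∈ Q, Module.finrank F π.direction = 2) →
        P.card ≤ Q.card →
        (ringChar F = 0 ∨ (P.card : ℝ) ≤ c₀ * (ringChar F : ℝ) ^ 2) →
        (∀ ℓ : AffineSubspace F (Fin 3 → F), Module.finrank F ℓ.direction = 1 →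
          (P.filter fun q => q ∈ ℓ).card ≤ k) →
        (((P ×ˢ Q).filter fun i => i.1 ∈ i.2).card : ℝ) ≤
          C * ((P.card : ℝ) ^ (1 / 2 : ℝ) * (Q.card : ℝ) + (k : ℝ) * (Q.card : ℝ)) := by
  intro c₀ hc₀
  obtain ⟨CH, hCH, hH⟩ := H c₀ hc₀
  refine ⟨4 * CH + 1, by positivity, ?_⟩
  intro F _ P Q k hQ hPQ hchar hk
  -- the set of incidences and the trivial bounds
  set Ip := (P ×ˢ Q).filter fun i => i.1 ∈ i.2 with hIp
  have hIpPQ : Ip.card ≤ P.card * Q.card := by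
    rw [← card_product]; exact card_filter_le _ _
  have hX0 : 0 ≤ (P.card : ℝ) ^ (1 / 2 : ℝ) * (Q.card : ℝ) := by positivity
  have hQ0 : (0 : ℝ) ≤ Q.card := Nat.cast_nonneg _
  -- `P = ∅`
  rcases P.eq_empty_or_nonempty with hP0 | ⟨p₀, hp₀⟩
  · have h0 : Ip.card = 0 := by rw [hIp, hP0]; simp
    rw [h0]
    push_cast
    positivity
  -- `k ≥ 1`: the line through `p₀` and `p₀ + e₀` contains a point of `P`
  have hk1 : 1 ≤ k := by
    have hne : p₀ ≠ p₀ + ![1, 0, 0] := fun h => by simpa using congr_fun h 0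
    obtain ⟨ℓ, hℓ, hp₀ℓ, -⟩ := exists_line_through hne
    exact le_trans (card_pos.2 ⟨p₀, mem_filter.2 ⟨hp₀, hp₀ℓ⟩⟩) (hk ℓ hℓ)
  have hk1' : (1 : ℝ) ≤ k := by exact_mod_cast hk1
  -- `k = 1`: at most one point, hence at most `|Q|` incidences
  by_cases hk2 : k < 2
  · have hP1 : P.card ≤ 1 := by
      by_contra hP1
      obtain ⟨a, ha, b, hb, hab⟩ := one_lt_card.1 (not_le.1 hP1)
      obtain ⟨ℓ, hℓ, haℓ, hbℓ⟩ := exists_line_through hab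
      have hsub : ({a, b} : Finset (Fin 3 → F)) ⊆ P.filter fun q => q ∈ ℓ := by
        intro c hc
        simp only [mem_insert, mem_singleton] at hc
        rcases hc with rfl | rfl
        · exact mem_filter.2 ⟨ha, haℓ⟩
        · exact mem_filter.2 ⟨hb, hbℓ⟩
      have h2 := (card_pair hab).symm.trans_le (card_le_card hsub)
      have := hk ℓ hℓ
      omega
    have hIQ : (Ip.card : ℝ) ≤ Q.card := by
      have : Ip.card ≤ Q.card := hIpPQ.trans (by nlinarith [hP1, Nat.zero_le Q.card])
      exact_mod_cast this
    calc (Ip.card : ℝ) ≤ Q.card := hIQ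
      _ = 1 * (1 * (Q.card : ℝ)) := by ring
      _ ≤ (4 * CH + 1) * ((k : ℝ) * Q.card) :=
          mul_le_mul (by linarith) (mul_le_mul_of_nonneg_right hk1' hQ0) (by positivity)
            (by positivity)
      _ ≤ (4 * CH + 1) * ((P.card : ℝ) ^ (1 / 2 : ℝ) * (Q.card : ℝ) + (k : ℝ) * Q.card) :=
          mul_le_mul_of_nonneg_left (le_add_of_nonneg_left hX0) (by positivity)
  push Not at hk2
  -- main case `k ≥ 2`: over the algebraic closure (infinite, same characteristic)
  have hcharK : ringChar (AlgebraicClosure F) = ringChar F := by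
    have h := (Algebra.charP_iff F (AlgebraicClosure F) (ringChar F)).1 (ringChar.charP F)
    exact ringChar.eq (AlgebraicClosure F) (ringChar F)
  have hmain := card_incidences_le_of_lineIntersection (AlgebraicClosure F)
    (hH (AlgebraicClosure F)) (algebraMap F (AlgebraicClosure F)) hcharK P Q k hQ hPQ hchar hk hk2
  have hk2' : (2 : ℝ) ≤ k := by exact_mod_cast hk2
  have hPQ' : (P.card : ℝ) ≤ Q.card := by exact_mod_cast hPQ
  have hk0 : (0 : ℝ) ≤ k := by linarith
  have h1 : ((k : ℝ) + 1) * P.card + ((k : ℝ) + 1) * Q.card ≤ 4 * k * Q.card := by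
    nlinarith [mul_nonneg (by linarith : (0 : ℝ) ≤ k + 1) (sub_nonneg.2 hPQ'),
      mul_nonneg (by linarith : (0 : ℝ) ≤ k - 1) hQ0]
  calc (Ip.card : ℝ)
      ≤ CH * ((P.card : ℝ) ^ (1 / 2 : ℝ) * Q.card + ((k : ℝ) + 1) * P.card
          + ((k : ℝ) + 1) * Q.card) := hmain
    _ ≤ CH * ((P.card : ℝ) ^ (1 / 2 : ℝ) * Q.card + 4 * k * Q.card) :=
        mul_le_mul_of_nonneg_left (by linarith) hCH.le
    _ ≤ (4 * CH + 1) * ((P.card : ℝ) ^ (1 / 2 : ℝ) * (Q.card : ℝ) + (k : ℝ) * Q.card) := by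
        nlinarith [mul_nonneg hCH.le hX0, mul_nonneg (mul_nonneg hCH.le hk0) hQ0,
          mul_nonneg hk0 hQ0, hX0]

open scoped Classical in
/-- **Rudnev's point–plane incidence theorem from the bipartite Guth–Katz line bound**
(de Zeeuw 2016, Lemma 3.1) assumed for ALL fields: the special case of
`rudnev_pointPlaneIncidence_of_lineIntersection_closed` (a hypothesis quantified over all fields
restricts to algebraically closed ones).
[cite: deZeeuw2016, Theorem 1.1, Lemma 2.1 and §4 (proof of Theorem 4.1); hypothesis = Lemma 3.1] -/
theorem rudnev_pointPlaneIncidence_of_lineIntersection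
    (H : ∀ c₀ : ℝ, 0 < c₀ → ∃ C : ℝ, 0 < C ∧
      ∀ (K : Type) [Field K] (L M : Finset (AffineSubspace K (Fin 3 → K))) (s t : ℕ),
        (∀ ℓ ∈ L, Module.finrank K ℓ.direction = 1) →
        (∀ m ∈ M, Module.finrank K m.direction = 1) →
        Disjoint L M →
        L.card ≤ M.card →
        (ringChar K = 0 ∨ (L.card : ℝ) ≤ c₀ * (ringChar K : ℝ) ^ 2) →
        (∀ G : MvPolynomial (Fin 3) K, G ≠ 0 → G.totalDegree ≤ 2 →
          (L.filter fun ℓ => ∀ z ∈ ℓ, MvPolynomial.eval z G = 0).card < s ∨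
          (M.filter fun m => ∀ z ∈ m, MvPolynomial.eval z G = 0).card < t) →
        ∀ I : Finset (Fin 3 → K),
          (∀ z ∈ I, (∃ ℓ ∈ L, z ∈ ℓ) ∧ (∃ m ∈ M, z ∈ m)) →
          (I.card : ℝ) ≤ C * ((L.card : ℝ) ^ (1 / 2 : ℝ) * (M.card : ℝ)
            + (t : ℝ) * (L.card : ℝ) + (s : ℝ) * (M.card : ℝ))) :
    ∀ c₀ : ℝ, 0 < c₀ → ∃ C : ℝ, 0 < C ∧
      ∀ (F : Type) [Field F] (P : Finset (Fin 3 → F)) (Q : Finset (AffineSubspace F (Fin 3 → F)))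
        (k : ℕ),
        (∀ π ∈ Q, Module.finrank F π.direction = 2) →
        P.card ≤ Q.card →
        (ringChar F = 0 ∨ (P.card : ℝ) ≤ c₀ * (ringChar F : ℝ) ^ 2) →
        (∀ ℓ : AffineSubspace F (Fin 3 → F), Module.finrank F ℓ.direction = 1 →
          (P.filter fun q => q ∈ ℓ).card ≤ k) →
        (((P ×ˢ Q).filter fun i => i.1 ∈ i.2).card : ℝ) ≤
          C * ((P.card : ℝ) ^ (1 / 2 : ℝ) * (Q.card : ℝ) + (k : ℝ) * (Q.card : ℝ)) :=
  rudnev_pointPlaneIncidence_of_lineIntersection_closed fun c₀ hc₀ => by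
    obtain ⟨C, hC, h⟩ := H c₀ hc₀
    exact ⟨C, hC, fun K _ _ => h K⟩

open DeZeeuw in
open scoped Classical in
/-- **Stevens–de Zeeuw, Theorem 4, from the bipartite Guth–Katz line bound over algebraically
closed fields** (de Zeeuw 2016, Lemma 3.1 for algebraically closed `K`): chaining
`rudnev_pointPlaneIncidence_of_lineIntersection_closed` (de Zeeuw §§2, 4) with
`stevensDeZeeuw_thm4_of_pointPlane` (Stevens–de Zeeuw §2) reduces the named fact
`stevensDeZeeuw_thm4` to Lemma 3.1 over algebraically closed fields alone — the
Guth–Katz–Kollár theory of lines on surfaces.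
[cite: StevensDeZeeuw2017, Theorem 4; deZeeuw2016, Lemma 3.1 (hypothesis)] -/
theorem stevensDeZeeuw_thm4_of_lineIntersection_closed
    (H : ∀ c₀ : ℝ, 0 < c₀ → ∃ C : ℝ, 0 < C ∧
      ∀ (K : Type) [Field K] [IsAlgClosed K] (L M : Finset (AffineSubspace K (Fin 3 → K)))
        (s t : ℕ),
        (∀ ℓ ∈ L, Module.finrank K ℓ.direction = 1) →
        (∀ m ∈ M, Module.finrank K m.direction = 1) →
        Disjoint L M →
        L.card ≤ M.card →
        (ringChar K = 0 ∨ (L.card : ℝ) ≤ c₀ * (ringChar K : ℝ) ^ 2) →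
        (∀ G : MvPolynomial (Fin 3) K, G ≠ 0 → G.totalDegree ≤ 2 →
          (L.filter fun ℓ => ∀ z ∈ ℓ, MvPolynomial.eval z G = 0).card < s ∨
          (M.filter fun m => ∀ z ∈ m, MvPolynomial.eval z G = 0).card < t) →
        ∀ I : Finset (Fin 3 → K),
          (∀ z ∈ I, (∃ ℓ ∈ L, z ∈ ℓ) ∧ (∃ m ∈ M, z ∈ m)) →
          (I.card : ℝ) ≤ C * ((L.card : ℝ) ^ (1 / 2 : ℝ) * (M.card : ℝ)
            + (t : ℝ) * (L.card : ℝ) + (s : ℝ) * (M.card : ℝ))) :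
    stevensDeZeeuw_thm4 :=
  stevensDeZeeuw_thm4_of_pointPlane (rudnev_pointPlaneIncidence_of_lineIntersection_closed H)

open DeZeeuw in
open scoped Classical in
/-- **Stevens–de Zeeuw, Theorem 4, from the bipartite Guth–Katz line bound** (de Zeeuw 2016,
Lemma 3.1): chaining `rudnev_pointPlaneIncidence_of_lineIntersection` (de Zeeuw §§2, 4) with
`stevensDeZeeuw_thm4_of_pointPlane` (Stevens–de Zeeuw §2) reduces the named fact
`stevensDeZeeuw_thm4` to Lemma 3.1 alone — the Guth–Katz–Kollár theory of lines on surfaces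
over arbitrary fields. [cite: StevensDeZeeuw2017, Theorem 4; deZeeuw2016, Lemma 3.1 (hypothesis)] -/
theorem stevensDeZeeuw_thm4_of_lineIntersection
    (H : ∀ c₀ : ℝ, 0 < c₀ → ∃ C : ℝ, 0 < C ∧
      ∀ (K : Type) [Field K] (L M : Finset (AffineSubspace K (Fin 3 → K))) (s t : ℕ),
        (∀ ℓ ∈ L, Module.finrank K ℓ.direction = 1) →
        (∀ m ∈ M, Module.finrank K m.direction = 1) →
        Disjoint L M →
        L.card ≤ M.card →
        (ringChar K = 0 ∨ (L.card : ℝ) ≤ c₀ * (ringChar K : ℝ) ^ 2) →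
        (∀ G : MvPolynomial (Fin 3) K, G ≠ 0 → G.totalDegree ≤ 2 →
          (L.filter fun ℓ => ∀ z ∈ ℓ, MvPolynomial.eval z G = 0).card < s ∨
          (M.filter fun m => ∀ z ∈ m, MvPolynomial.eval z G = 0).card < t) →
        ∀ I : Finset (Fin 3 → K),
          (∀ z ∈ I, (∃ ℓ ∈ L, z ∈ ℓ) ∧ (∃ m ∈ M, z ∈ m)) →
          (I.card : ℝ) ≤ C * ((L.card : ℝ) ^ (1 / 2 : ℝ) * (M.card : ℝ)
            + (t : ℝ) * (L.card : ℝ) + (s : ℝ) * (M.card : ℝ))) :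
    stevensDeZeeuw_thm4 :=
  stevensDeZeeuw_thm4_of_pointPlane (rudnev_pointPlaneIncidence_of_lineIntersection H)

end Literature.Combinatorics.Additive
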